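import Mathlib
import HarnessLib
import Summits.Ventures.LatticeQCDFlow.Exactness.LatticeSiteDerivatives
import Summits.Ventures.LatticeQCDFlow.Exactness.SphereLOFlowAction

/-!
# E–S's lattice operator `Σ_k ∂̃_k·∂̃_k` preserves the lattice polynomials of each degree (the polynomial instance of the Poisson solver)

HONEST FRAMING: exact (Metropolis-corrected) sampling algorithms for lattice gauge theory;
figures of merit are autocorrelation/cost numbers at stated couplings and volumes; no
continuum-physics claim.

Venture `LatticeQCDFlow` (cell pub-lqcd), topic `Exactness`; FANOUT row 7 (`s0-cpn-null`).  NEW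
WORK of the cell over Mathlib and the tree's `Exactness/LatticeSitePolynomials.lean` (`polyS`),
`Exactness/LatticeSiteDerivatives.lean` (`siteDeriv`, `siteEuler` and their degree bookkeeping),
`Exactness/SphereLOFlowAction.lean` (E–S's site operator `siteLaplacian k` = `∂̃_k·∂̃_k`) and
`Exactness/SphereTangentialLaplacian.lean` (`laplacian_comp_normalize`: on `‖u‖ = 1`,
`Δ(f∘ν)(u) = Δf(u) − D²f(u)(u,u) − (d−1)·Df(u) u`); nothing is cited as a fact.  Printed
counterpart, NAMED ONLY: M. Lüscher, Commun. Math. Phys. 293 (2010) 899, §4.4 (after eq. (4.22):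
"since `Δ` maps any polynomial in `W₀, W₁, …` into another polynomial in these variables, it is
possible to work out the expansion" — each order of the flow action by linear algebra in a
finite-dimensional invariant space); Engel–Schaefer, Comput. Phys. Commun. 182 (2011) 2107, §3
(the display before eq. (15): `−∂̃ⁱ_n∂̃ⁱ_n f = (d−1) x_n·∇_n f − tr[(1 − x_n x_nᵀ) H_f]`).

## Content (`E` finite-dimensional real inner product space, frame `b`, `d = dim E`; `Λ` finite)

* `siteDeriv_update` — site derivatives read along a section; **`fderiv_fderiv_section`** — the
  second derivative of the site section is the iterated site derivative
  `D²_k F(x)(u, w) = D_k(D_k F · w)(x) u`; `siteFlatLap k F = Σ_i D_k(D_k F · b_i) · b_i` and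
  **`laplacian_section_eq_siteFlatLap`** (the flat Laplacian of the section);
  **`fderiv_fderiv_section_self_self`** — `D²_k F(x)(x_k, x_k) = E_k(E_k F)(x) − E_k F(x)`
  (`E_k` the Euler operator).
* `ambSiteLap k F = siteFlatLap k F − E_k(E_k F) − (d − 2)·E_k F` — THE AMBIENT FORM OF E–S's SITE
  OPERATOR: **`siteLaplacian_eq_ambSiteLap`**: `∂̃_k·∂̃_k F (x) = ambSiteLap k F x` whenever
  `‖x k‖ = 1` (from `laplacian_comp_normalize`).
* **`ambSiteLap_mem_polyS`** — `ambSiteLap k` maps `polyS N` into itself (flat second derivatives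
  lower the degree by two, the Euler operator preserves it); **`polyS_siteLaplacian_stable`** — for
  `f ∈ polyS N` the function `Σ_k ∂̃_k·∂̃_k f` agrees ON THE PRODUCT OF UNIT SPHERES with the
  member `Σ_k ambSiteLap k f` of `polyS N`.  This is exactly the stability hypothesis `hΔ` of
  `Exactness/SphereLatticePoissonSolver.exists_luscher_poisson_solution` for `P = polyS N`; with
  `one_mem_polyS`, `contDiff_of_mem_polyS` and `polyS.finiteDimensional` every hypothesis of that
  solver is met by the lattice polynomials of any fixed degree (`Exactness/SphereLuscherSeriesExistence`).

Sanity checks against the tree: on a site-linear section `ambSiteLap` gives `−(d−1)·f`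
(`SphereLOFlowAction.siteLaplacian_esAction`), on a homogeneous quadratic `Δq − 2d·q`
(`SphereHomogeneousLaplacian`, `n(n+d−2)` at `n = 2`).

NOT CLAIMED: anything about measures or the Poisson problem itself (tree: `SphereLatticeGreen`,
`SphereLatticeLuscherKernel`, `SphereLatticePoissonSolver`); anything quantitative.
-/

noncomputable section

namespace Summit.Ventures.LatticeQCDFlow.Exactness

open Function Set NormedSpace InnerProductSpace Laplacian Metric
open scoped RealInnerProductSpace ContDiff

variable {Λ : Type*} {E : Type*} [NormedAddCommGroup E] [InnerProductSpace ℝ E]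

/-! ## §1 Second derivatives of the site sections as iterated site derivatives -/

section SecondOrder

variable [Fintype Λ] [DecidableEq Λ]

omit [Fintype Λ] in
/-- A site derivative read along the section through `x`: `D_k F(x[k ← y]) w = d/dy F(x[k ← y]) w`. -/
theorem siteDeriv_update (k : Λ) (w : E) (F : (Λ → E) → ℝ) (x : Λ → E) (y : E) :
    siteDeriv k w F (update x k y) = fderiv ℝ (fun y' => F (update x k y')) y w := by
  simp only [siteDeriv, update_idem, update_self]

omit [Fintype Λ] in
/-- The Euler operator read along the section through `x`: `E_k F(x[k ← y]) = d/dy F(x[k ← y]) y`. -/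
theorem siteEuler_update (k : Λ) (F : (Λ → E) → ℝ) (x : Λ → E) (y : E) :
    siteEuler k F (update x k y) = fderiv ℝ (fun y' => F (update x k y')) y y := by
  simp only [siteEuler, siteDeriv, update_idem, update_self]

omit [Fintype Λ] in
/-- A smooth functional has `C²` site sections. -/
theorem contDiff_two_section {F : (Λ → E) → ℝ} {x : Λ → E} {k : Λ}
    (hF : ContDiff ℝ ∞ (fun y => F (update x k y))) : ContDiff ℝ 2 (fun y => F (update x k y)) :=
  contDiff_infty.1 hF 2

omit [Fintype Λ] in
/-- **The second derivative of a site section is the iterated site derivative**: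
`D²_k F(x)(u, w) = D_k (D_k F · w)(x) u` for a `C²` section. -/
theorem fderiv_fderiv_section {F : (Λ → E) → ℝ} {x : Λ → E} {k : Λ}
    (hF : ContDiff ℝ 2 (fun y => F (update x k y))) (u w : E) :
    fderiv ℝ (fderiv ℝ (fun y => F (update x k y))) (x k) u w = siteDeriv k u (siteDeriv k w F) x := by
  set g : E → ℝ := fun y => F (update x k y) with hg
  have hdg : DifferentiableAt ℝ (fderiv ℝ g) (x k) :=
    (hF.contDiffAt.fderiv_right (m := 1) (by norm_num)).differentiableAt (by norm_num)
  have e : (fun y => siteDeriv k w F (update x k y)) = fun y => fderiv ℝ g y w :=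
    funext fun y => siteDeriv_update k w F x y
  show _ = fderiv ℝ (fun y => siteDeriv k w F (update x k y)) (x k) u
  rw [e, fderiv_clm_apply hdg (differentiableAt_const w)]
  simp

omit [Fintype Λ] in
/-- **Euler of Euler**: `D²_k F(x)(x_k, x_k) = E_k(E_k F)(x) − E_k F(x)` for a `C²` section
(differentiate `y ↦ D_k F(x[k←y]) y` along `y`). -/
theorem fderiv_fderiv_section_self_self {F : (Λ → E) → ℝ} {x : Λ → E} {k : Λ}
    (hF : ContDiff ℝ 2 (fun y => F (update x k y))) :
    fderiv ℝ (fderiv ℝ (fun y => F (update x k y))) (x k) (x k) (x k) =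
      siteEuler k (siteEuler k F) x - siteEuler k F x := by
  set g : E → ℝ := fun y => F (update x k y) with hg
  have hdg : DifferentiableAt ℝ (fderiv ℝ g) (x k) :=
    (hF.contDiffAt.fderiv_right (m := 1) (by norm_num)).differentiableAt (by norm_num)
  have e : (fun y => siteEuler k F (update x k y)) = fun y => fderiv ℝ g y y :=
    funext fun y => siteEuler_update k F x y
  have h1 : siteEuler k (siteEuler k F) x =
      fderiv ℝ (fderiv ℝ g) (x k) (x k) (x k) + fderiv ℝ g (x k) (x k) := by
    show fderiv ℝ (fun y => siteEuler k F (update x k y)) (x k) (x k) = _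
    rw [e, fderiv_clm_apply (u := fun y => y) hdg differentiableAt_id]
    simp [add_comm]
  have h2 : siteEuler k F x = fderiv ℝ g (x k) (x k) := rfl
  rw [h1, h2]; ring

variable [FiniteDimensional ℝ E]

/-- **The flat site Laplacian** `Σ_i D_k(D_k F · b_i)(x) b_i` in the standard frame. -/
def siteFlatLap (k : Λ) (F : (Λ → E) → ℝ) (x : Λ → E) : ℝ :=
  ∑ i, siteDeriv k (stdOrthonormalBasis ℝ E i) (siteDeriv k (stdOrthonormalBasis ℝ E i) F) x

omit [Fintype Λ] in
/-- **The Laplacian of a `C²` site section is the flat site Laplacian.** -/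
theorem laplacian_section_eq_siteFlatLap {F : (Λ → E) → ℝ} {x : Λ → E} {k : Λ}
    (hF : ContDiff ℝ 2 (fun y => F (update x k y))) :
    Δ (fun y => F (update x k y)) (x k) = siteFlatLap k F x := by
  rw [congrFun (laplacian_eq_iteratedFDeriv_orthonormalBasis (fun y => F (update x k y))
    (stdOrthonormalBasis ℝ E)) (x k)]
  unfold siteFlatLap
  refine Finset.sum_congr rfl fun i _ => ?_
  rw [iteratedFDeriv_two_apply]
  exact fderiv_fderiv_section hF _ _

/-- **The ambient form of E–S's site operator**:
`ambSiteLap k F = siteFlatLap k F − E_k(E_k F) − (d − 2)·E_k F`, `d = dim E`. -/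
def ambSiteLap (k : Λ) (F : (Λ → E) → ℝ) : (Λ → E) → ℝ := fun x =>
  siteFlatLap k F x - siteEuler k (siteEuler k F) x -
    ((Module.finrank ℝ E : ℝ) - 2) * siteEuler k F x

omit [Fintype Λ] in
/-- **`∂̃_k·∂̃_k F (x) = ambSiteLap k F x` on `‖x k‖ = 1`** (E–S's display before eq. (15), via
`laplacian_comp_normalize`: `Δ(g∘ν) = Δg − D²g(u)(u,u) − (d−1)·Dg(u) u`, with
`D²g(u)(u,u) = E_k(E_k F) − E_k F` and `Dg(u) u = E_k F`). -/
theorem siteLaplacian_eq_ambSiteLap {F : (Λ → E) → ℝ} {x : Λ → E} {k : Λ}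
    (hF : ContDiff ℝ 2 (fun y => F (update x k y))) (hx : ‖x k‖ = 1) :
    siteLaplacian k F x = ambSiteLap k F x := by
  unfold siteLaplacian ambSiteLap
  rw [laplacian_comp_normalize hx hF.contDiffAt, laplacian_section_eq_siteFlatLap hF,
    fderiv_fderiv_section_self_self hF]
  have h2 : fderiv ℝ (fun y => F (update x k y)) (x k) (x k) = siteEuler k F x := rfl
  rw [h2]; ring

/-- **The lattice operator on the product of unit spheres**:
`Σ_k ∂̃_k·∂̃_k F (x) = Σ_k ambSiteLap k F x` when every `‖x k‖ = 1` (`F` smooth). -/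
theorem sum_siteLaplacian_eq_sum_ambSiteLap {F : (Λ → E) → ℝ} (hF : ContDiff ℝ ∞ F) {x : Λ → E}
    (hx : ∀ k, ‖x k‖ = 1) : ∑ k, siteLaplacian k F x = ∑ k, ambSiteLap k F x :=
  Finset.sum_congr rfl fun k _ =>
    siteLaplacian_eq_ambSiteLap (contDiff_two_section (hF.comp (contDiff_update ∞ x k))) (hx k)

end SecondOrder

/-! ## §2 Stability of the lattice polynomials of each degree -/

section Stability

variable [FiniteDimensional ℝ E] [Fintype Λ] [DecidableEq Λ]

/-- The flat site Laplacian lowers the degree by two: `polyS N → polyS (N − 2)`. -/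
theorem siteFlatLap_mem_polyS (k : Λ) {N : ℕ} {F : (Λ → E) → ℝ} (hF : F ∈ polyS Λ E N) :
    siteFlatLap k F ∈ polyS Λ E (N - 2) := by
  have e : siteFlatLap k F = ∑ i, siteDeriv k (stdOrthonormalBasis ℝ E i)
      (siteDeriv k (stdOrthonormalBasis ℝ E i) F) := by
    funext x; simp only [siteFlatLap, Finset.sum_apply]
  rw [e]
  refine Submodule.sum_mem _ fun i _ => ?_
  have h := siteDeriv_mem_polyS k (stdOrthonormalBasis ℝ E i)
    (siteDeriv_mem_polyS k (stdOrthonormalBasis ℝ E i) hF)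
  have hN : N - 1 - 1 = N - 2 := by omega
  rwa [hN] at h

/-- **`ambSiteLap k` maps `polyS N` into itself** (Lüscher §4.4: "`Δ` maps any polynomial …
into another polynomial"). -/
theorem ambSiteLap_mem_polyS (k : Λ) {N : ℕ} {F : (Λ → E) → ℝ} (hF : F ∈ polyS Λ E N) :
    ambSiteLap k F ∈ polyS Λ E N := by
  have e : ambSiteLap k F = siteFlatLap k F - siteEuler k (siteEuler k F) -
      ((Module.finrank ℝ E : ℝ) - 2) • siteEuler k F := by
    funext x; simp only [ambSiteLap, Pi.sub_apply, Pi.smul_apply, smul_eq_mul]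
  rw [e]
  exact Submodule.sub_mem _ (Submodule.sub_mem _ (polyS_mono (Nat.sub_le N 2)
    (siteFlatLap_mem_polyS k hF)) (siteEuler_mem_polyS k (siteEuler_mem_polyS k hF)))
    (Submodule.smul_mem _ _ (siteEuler_mem_polyS k hF))

/-- The summed ambient operator `Σ_k ambSiteLap k` maps `polyS N` into itself. -/
theorem sum_ambSiteLap_mem_polyS {N : ℕ} {F : (Λ → E) → ℝ} (hF : F ∈ polyS Λ E N) :
    (fun x => ∑ k, ambSiteLap k F x) ∈ polyS Λ E N := by
  have e : (fun x => ∑ k, ambSiteLap k F x) = ∑ k, ambSiteLap k F := by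
    funext x; simp only [Finset.sum_apply]
  rw [e]
  exact Submodule.sum_mem _ fun k _ => ambSiteLap_mem_polyS k hF

/-- **THE POLYNOMIAL INSTANCE OF THE POISSON SOLVER'S STABILITY HYPOTHESIS.**  For every lattice
polynomial `f` of degree `≤ N` there is a lattice polynomial `g` of degree `≤ N` (namely
`Σ_k ambSiteLap k f`) with `Σ_k ∂̃_k·∂̃_k f = g` ON THE PRODUCT OF UNIT SPHERES — hypothesis `hΔ` of
`SphereLatticePoissonSolver.exists_luscher_poisson_solution` for `P = polyS Λ E N`. -/
theorem polyS_siteLaplacian_stable (N : ℕ) :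
    ∀ f ∈ polyS Λ E N, ∃ g ∈ polyS Λ E N, ∀ ξ : Λ → sphere (0 : E) 1,
      ∑ k, siteLaplacian k f (fun n => (ξ n : E)) = g (fun n => (ξ n : E)) := by
  intro f hf
  refine ⟨fun x => ∑ k, ambSiteLap k f x, sum_ambSiteLap_mem_polyS hf, fun ξ => ?_⟩
  exact sum_siteLaplacian_eq_sum_ambSiteLap (contDiff_of_mem_polyS hf) fun k => by simp

omit [DecidableEq Λ] in
/-- Members of `polyS N` are `C²` (the smoothness hypothesis `hs` of the Poisson solver). -/
theorem polyS_contDiff_two (N : ℕ) : ∀ f ∈ polyS Λ E N, ContDiff ℝ 2 f :=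
  fun _ hf => contDiff_infty.1 (contDiff_of_mem_polyS hf) 2

end Stability

end Summit.Ventures.LatticeQCDFlow.Exactness

end
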